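import Literature.AlgebraicGeometry.PlaneCurves.HessePencilHessian
import HarnessLib

/-!
# The nine base points of the Hesse pencil as `𝔽₃²` and the action of the Hessian group on them (Artebani–Dolgachev §2, §4)

Topic `Literature/AlgebraicGeometry/PlaneCurves`, namespace `Literature.AlgebraicGeometry.PlaneCurves`.
Lane `lit-hodgefound`, seat `lit-hodgefound-p37`, row g18-#9; a sequel of `HessePencilHessianGroup`
(g18-#5: the generators `g₀, …, g₄` as substitutions, `g₃² = 3g₀`, the stabilizer of `p₀`).
Everything here is PROVED; no definition, no named fact.

Source followed — M. Artebani, I. Dolgachev, *The Hesse pencil of plane cubic curves*,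
L'Enseignement Math. (2) 55 (2009) 235–273 [arXiv:math/0611590, held `paper:arxiv-math_0611590`
p0004 L16–L40, p0008 L9–L54], VERBATIM:

> (§2) its nine base points are in the Hesse configuration. In fact, they are the inflection
> points of any smooth curve in the pencil. In coordinates they are:
> `p₀ = (0, 1, −1), p₁ = (0, 1, −ε), p₂ = (0, 1, −ε²), p₃ = (1, 0, −1), p₄ = (1, 0, −ε²),`
> `p₅ = (1, 0, −ε), p₆ = (1, −1, 0), p₇ = (1, −ε, 0), p₈ = (1, −ε², 0)`,
> where `ε` denotes a primitive third root of `1`. […] we can identify the nine base points with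
> elements of `(ℤ/3ℤ)²` as follows
> `p₀ p₁ p₂ / p₃ p₄ p₅ / p₆ p₇ p₈ = (0,0) (1,0) (2,0) / (0,1) (1,1) (2,1) / (0,2) (1,2) (2,2)`.
> (§4) `g₀(x, y, z) = (x, z, y)`, `g₁(x, y, z) = (y, z, x)`, `g₂(x, y, z) = (x, εy, ε²z)` […] `g₁`
> induces the translation by the 3-torsion point `p₃` and `g₂` that by the point `p₁`. […]
> `g₃ = [[1,1,1],[1,ε,ε²],[1,ε²,ε]]`, `g₄ = [[1,0,0],[0,ε,0],[0,0,ε]]` […] The Hessian group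
> clearly acts on the set of nine points `pᵢ`, giving a natural homomorphism from `G₂₁₆` to
> `Aff₂(3)`, the affine group of `𝔽₃²`. In fact, the Hessian group is the subgroup of index 2 of
> `Aff₂(3)` of transformations with linear part of determinant 1. In this action the group
> `G₂₁₆` is realized as a 2-transitive subgroup of the permutation group `S₉` on `{0, 1, …, 8}`
> generated by permutations `T = (031)(475)(682)` and `U = (147)(285)` (see [Coxeter], 7.7). The
> stabilizer subgroup of the point `p₀` is generated by `U` and `TUT⁻¹ = (354)(678)` and
> coincides with `⟨g₃, g₄⟩`.

## Dictionary

* The nine points are the table `𝐩[ω] : Fin 9 → (Fin 3 → K)` (local notation, in the printed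
  order), `ω` a primitive cube root of unity (`ω² + ω + 1 = 0`); the matrices act on points by
  `M *ᵥ v` (as in `HessePencilHessianGroup.g₃_g₄_mulVec_p₀`); "`g` induces the permutation `σ`
  of the `pᵢ`" is `g *ᵥ pᵢ = cᵢ • p_{σ i}` with explicit non-zero scalars `cᵢ`.
* A–D's identification is the table `𝛂 : Fin 9 → ZMod 3 × ZMod 3` (local notation `𝛂`),
  `p_{3b+a} ↦ (a, b)`; permutations of `{0, …, 8}` are composed left to right as in [Coxeter]
  (`x^{TU} = (x^T)^U`), so `TUT⁻¹` is `i ↦ T⁻¹(U(T(i)))` as functions.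

## What is here

* §1 `hesse_eval_basePoints` — all nine `pᵢ` lie on every `H_μ` (`ω³ = 1`).
* §2 **The induced permutations** (`ω² + ω + 1 = 0`; scalars explicit): `g₀_mulVec_basePoints`
  (`σ₀ = (12)(36)(48)(57)`), `g₁_mulVec_basePoints` (`σ₁ = (063)(174)(285)`),
  `g₂_mulVec_basePoints` (`σ₂ = (012)(345)(678)`), `g₃_mulVec_basePoints`
  (`σ₃ = (1623)(4785)`, fixing `0`), `g₄_mulVec_basePoints` (`σ₄ = (354)(678)`, fixing
  `0, 1, 2`).
* §3 **"a natural homomorphism from `G₂₁₆` to `Aff₂(3)` … with linear part of determinant 1"**,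
  checked on the generators through `𝛂` (`decide`): `affine_σ₀` (`v ↦ −v`), `affine_σ₁`
  (`v ↦ v + (0, 2)`, the translation by `−p₃ = p₆` — "g₁ induces the translation by the 3-torsion
  point `p₃`" up to the point/coordinate convention), `affine_σ₂` (`v ↦ v + (1, 0)`: "`g₂` that by
  the point `p₁`"), `affine_σ₃` (`(a, b) ↦ (b, 2a)`, linear, `det = 1`), `affine_σ₄`
  (`(a, b) ↦ (a + 2b, b)`, linear, `det = 1`), `det_linearPart_σ₃_σ₄`.
* §4 **"`TUT⁻¹ = (354)(678)`"** with `T = (031)(475)(682)`, `U = (147)(285)`: `T_inv_comp`,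
  `T_U_T_inv` (`decide`: `TUT⁻¹ = σ₄`, the permutation induced by `g₄` — A–D's second generator
  of the stabilizer of `p₀`), `σ₄_cycles`; `affine_U` (`U` is the transvection
  `(a, b) ↦ (a, a + b)`; `U`, `σ₃`, `σ₄` fix `0`: "coincides with `⟨g₃, g₄⟩`"), `affine_T`
  (`T : (a, b) ↦ (b, 2a + 2b + 1)`, linear part of determinant `1`).

NOT here: that `⟨T, U⟩` has order `216` and is `2`-transitive, Proposition 4.1
(`G₂₁₆ ≅ Γ ⋊ SL(2, 𝔽₃)`), and the group law (translations as additions on the cubic).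
-/

set_option autoImplicit false

open MvPolynomial Matrix

namespace Literature.AlgebraicGeometry.PlaneCurves

universe u

/-- The Hesse cubic `H_μ = X³ + Y³ + Z³ − 3μXYZ` (local notation, no definition). -/
local notation3 "𝐇[" μ "]" =>
  (X 0 ^ 3 + X 1 ^ 3 + X 2 ^ 3 - C (3 * μ) * (X 0 * X 1 * X 2) : MvPolynomial (Fin 3) _)

/-- The nine base points `p₀, …, p₈` in the printed order (local notation, no definition). -/
local notation3 "𝐩[" ω "]" =>
  (![![(0 : _), 1, -1], ![0, 1, -ω], ![0, 1, -ω ^ 2], ![1, 0, -1], ![1, 0, -ω ^ 2], ![1, 0, -ω],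
      ![1, -1, 0], ![1, -ω, 0], ![1, -ω ^ 2, 0]] : Fin 9 → Fin 3 → _)

/-- `g₀ = (x, z, y)` (local notation, no definition). -/
local notation3 "𝐠₀" => (Matrix.of ![![(1 : _), 0, 0], ![0, 0, 1], ![0, 1, 0]] : Matrix (Fin 3) (Fin 3) _)

/-- `g₁ = (y, z, x)` (local notation, no definition). -/
local notation3 "𝐠₁" => (Matrix.of ![![(0 : _), 1, 0], ![0, 0, 1], ![1, 0, 0]] : Matrix (Fin 3) (Fin 3) _)

/-- `g₂ = diag(1, ε, ε²)` (local notation, no definition). -/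
local notation3 "𝐠₂[" ω "]" =>
  (Matrix.of ![![(1 : _), 0, 0], ![0, ω, 0], ![0, 0, ω ^ 2]] : Matrix (Fin 3) (Fin 3) _)

/-- `g₃ = [[1, 1, 1], [1, ε, ε²], [1, ε², ε]]` (local notation, no definition). -/
local notation3 "𝐠₃[" ω "]" =>
  (Matrix.of ![![(1 : _), 1, 1], ![1, ω, ω ^ 2], ![1, ω ^ 2, ω]] : Matrix (Fin 3) (Fin 3) _)

/-- `g₄ = diag(1, ε, ε)` (local notation, no definition). -/
local notation3 "𝐠₄[" ω "]" =>
  (Matrix.of ![![(1 : _), 0, 0], ![0, ω, 0], ![0, 0, ω]] : Matrix (Fin 3) (Fin 3) _)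

/-- The permutations of `{0, …, 8}` induced by `g₀, …, g₄` (local notations, no definitions). -/
local notation3 "σ₀" => (![0, 2, 1, 6, 8, 7, 3, 5, 4] : Fin 9 → Fin 9)
local notation3 "σ₁" => (![6, 7, 8, 0, 1, 2, 3, 4, 5] : Fin 9 → Fin 9)
local notation3 "σ₂" => (![1, 2, 0, 4, 5, 3, 7, 8, 6] : Fin 9 → Fin 9)
local notation3 "σ₃" => (![0, 6, 3, 1, 7, 4, 2, 8, 5] : Fin 9 → Fin 9)
local notation3 "σ₄" => (![0, 1, 2, 5, 3, 4, 7, 8, 6] : Fin 9 → Fin 9)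

/-- A–D's `T = (031)(475)(682)`, `U = (147)(285)` and `T⁻¹`, as functions on `Fin 9`
(local notations, no definitions). -/
local notation3 "𝐓" => (![3, 0, 6, 1, 7, 4, 8, 5, 2] : Fin 9 → Fin 9)
local notation3 "𝐓⁻¹" => (![1, 3, 8, 0, 5, 7, 2, 4, 6] : Fin 9 → Fin 9)
local notation3 "𝐔" => (![0, 4, 8, 3, 7, 2, 6, 1, 5] : Fin 9 → Fin 9)

/-- A–D's identification `p_{3b+a} ↦ (a, b) ∈ (ℤ/3ℤ)²` (local notation, no definition). -/
local notation3 "𝛂" => (![((0 : ZMod 3), (0 : ZMod 3)), (1, 0), (2, 0), (0, 1), (1, 1), (2, 1),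
  (0, 2), (1, 2), (2, 2)] : Fin 9 → ZMod 3 × ZMod 3)

section BasePoints

variable {K : Type u} [Field K]

/-! ## §1 The nine base points -/

/-- **"its nine base points … In coordinates they are: `p₀, …, p₈`"**: every `pᵢ` lies on every
member `H_μ` (`ω³ = 1`). [cite: ArtebaniDolgachev2009, §2 (the base points `p₀, …, p₈`)] -/
theorem hesse_eval_basePoints {ω : K} (hw : ω ^ 3 = 1) (μ : K) :
    ∀ i : Fin 9, eval ((𝐩[ω] : Fin 9 → Fin 3 → K) i) (𝐇[μ] : MvPolynomial (Fin 3) K) = 0 := by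
  have h6 : ω ^ 6 = 1 := by rw [show ω ^ 6 = (ω ^ 3) ^ 2 by ring, hw, one_pow]
  intro i
  fin_cases i <;> simp <;> (try ring_nf) <;> (try simp only [hw, h6]) <;>
    (try ring_nf)

/-! ## §2 The permutations of the base points induced by `g₀, …, g₄` -/

/-- `g₀ = (x, z, y)` induces `σ₀ = (12)(36)(48)(57)` on the base points:
`g₀ pᵢ = cᵢ p_{σ₀ i}` with `c = (−1, −ω, −ω², 1, 1, 1, 1, 1, 1)` (`ω² + ω + 1 = 0`).
[cite: ArtebaniDolgachev2009, §4 ("The Hessian group clearly acts on the set of nine points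
`pᵢ`")] -/
theorem g₀_mulVec_basePoints {ω : K} (hω : ω ^ 2 + ω + 1 = 0) :
    ∀ i : Fin 9, (𝐠₀ : Matrix (Fin 3) (Fin 3) K) *ᵥ (𝐩[ω] : Fin 9 → Fin 3 → K) i =
      (![-1, -ω, -ω ^ 2, 1, 1, 1, 1, 1, 1] : Fin 9 → K) i • (𝐩[ω] : Fin 9 → Fin 3 → K) (σ₀ i) := by
  have h3 : ω ^ 3 = 1 := by linear_combination (ω - 1) * hω
  intro i
  fin_cases i <;>
    (funext j; fin_cases j <;> simp [Matrix.mulVec, dotProduct, Fin.sum_univ_three] <;>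
      (try ring_nf) <;> (try simp only [h3]))

/-- `g₁ = (y, z, x)` induces `σ₁ = (063)(174)(285)` (`pᵢ ↦ p_{i+6 mod 9}` in the printed
indexing): `g₁ pᵢ = cᵢ p_{σ₁ i}`, `c = (1, 1, 1, −1, −ω², −ω, −1, −ω, −ω²)`.
[cite: ArtebaniDolgachev2009, §4 ("`g₁` induces the translation by the 3-torsion point
`p₃`")] -/
theorem g₁_mulVec_basePoints {ω : K} (hω : ω ^ 2 + ω + 1 = 0) :
    ∀ i : Fin 9, (𝐠₁ : Matrix (Fin 3) (Fin 3) K) *ᵥ (𝐩[ω] : Fin 9 → Fin 3 → K) i =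
      (![1, 1, 1, -1, -ω ^ 2, -ω, -1, -ω, -ω ^ 2] : Fin 9 → K) i •
        (𝐩[ω] : Fin 9 → Fin 3 → K) (σ₁ i) := by
  have h3 : ω ^ 3 = 1 := by linear_combination (ω - 1) * hω
  intro i
  fin_cases i <;>
    (funext j; fin_cases j <;> simp [Matrix.mulVec, dotProduct, Fin.sum_univ_three] <;>
      (try ring_nf) <;> (try simp only [h3]))

/-- `g₂ = diag(1, ε, ε²)` induces `σ₂ = (012)(345)(678)`: `g₂ pᵢ = cᵢ p_{σ₂ i}`,
`c = (ω, ω, ω, 1, 1, 1, 1, 1, 1)`. [cite: ArtebaniDolgachev2009, §4 ("`g₂` that by the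
point `p₁`")] -/
theorem g₂_mulVec_basePoints {ω : K} (hω : ω ^ 2 + ω + 1 = 0) :
    ∀ i : Fin 9, (𝐠₂[ω] : Matrix (Fin 3) (Fin 3) K) *ᵥ (𝐩[ω] : Fin 9 → Fin 3 → K) i =
      (![ω, ω, ω, 1, 1, 1, 1, 1, 1] : Fin 9 → K) i • (𝐩[ω] : Fin 9 → Fin 3 → K) (σ₂ i) := by
  have h3 : ω ^ 3 = 1 := by linear_combination (ω - 1) * hω
  have h4 : ω ^ 4 = ω := by linear_combination (ω ^ 2 - ω) * hω
  intro i
  fin_cases i <;>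
    (funext j; fin_cases j <;> simp [Matrix.mulVec, dotProduct, Fin.sum_univ_three] <;>
      (try ring_nf) <;> (try simp only [h3, h4]))

/-- `g₃` induces `σ₃ = (1623)(4785)`, fixing `p₀`: `g₃ pᵢ = cᵢ p_{σ₃ i}` with
`c = (ω − ω², 1 − ω, 1 − ω², 1 − ω², 1 − ω², 1 − ω, 1 − ω, 1 − ω, 1 − ω²)`
(`ω² + ω + 1 = 0`). [cite: ArtebaniDolgachev2009, §4 ("The stabilizer subgroup of the point `p₀`
… coincides with `⟨g₃, g₄⟩`")] -/
theorem g₃_mulVec_basePoints {ω : K} (hω : ω ^ 2 + ω + 1 = 0) :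
    ∀ i : Fin 9, (𝐠₃[ω] : Matrix (Fin 3) (Fin 3) K) *ᵥ (𝐩[ω] : Fin 9 → Fin 3 → K) i =
      (![ω - ω ^ 2, 1 - ω, 1 - ω ^ 2, 1 - ω ^ 2, 1 - ω ^ 2, 1 - ω, 1 - ω, 1 - ω, 1 - ω ^ 2] :
          Fin 9 → K) i • (𝐩[ω] : Fin 9 → Fin 3 → K) (σ₃ i) := by
  have h2 : ω ^ 2 = -ω - 1 := by linear_combination hω
  have h3 : ω ^ 3 = 1 := by linear_combination (ω - 1) * hω
  have h4 : ω ^ 4 = ω := by linear_combination (ω ^ 2 - ω) * hω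
  intro i
  fin_cases i <;>
    (funext j; fin_cases j <;> simp [Matrix.mulVec, dotProduct, Fin.sum_univ_three] <;>
      (try ring_nf) <;> (try simp only [h2, h3, h4]) <;> (try ring_nf))

/-- `g₄ = diag(1, ε, ε)` induces `σ₄ = (354)(678)`, fixing `p₀, p₁, p₂`:
`g₄ pᵢ = cᵢ p_{σ₄ i}`, `c = (ω, ω, ω, 1, 1, 1, 1, 1, 1)`.
[cite: ArtebaniDolgachev2009, §4 ("`TUT⁻¹ = (354)(678)` … coincides with `⟨g₃, g₄⟩`")] -/
theorem g₄_mulVec_basePoints {ω : K} (hω : ω ^ 2 + ω + 1 = 0) :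
    ∀ i : Fin 9, (𝐠₄[ω] : Matrix (Fin 3) (Fin 3) K) *ᵥ (𝐩[ω] : Fin 9 → Fin 3 → K) i =
      (![ω, ω, ω, 1, 1, 1, 1, 1, 1] : Fin 9 → K) i • (𝐩[ω] : Fin 9 → Fin 3 → K) (σ₄ i) := by
  have h3 : ω ^ 3 = 1 := by linear_combination (ω - 1) * hω
  intro i
  fin_cases i <;>
    (funext j; fin_cases j <;> simp [Matrix.mulVec, dotProduct, Fin.sum_univ_three] <;>
      (try ring_nf) <;> (try simp only [h3]))

end BasePoints

/-! ## §3 The affine dictionary `p_{3b+a} ↦ (a, b)` -/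

/-- `g₀` acts on `𝔽₃²` as `v ↦ −v` (the inversion of the group law).
[cite: ArtebaniDolgachev2009, §2 (the identification with `(ℤ/3ℤ)²`), §4] -/
theorem affine_σ₀ : ∀ i : Fin 9, 𝛂 (σ₀ i) = -𝛂 i := by decide

/-- `g₁` acts on `𝔽₃²` as the translation `v ↦ v + (0, 2)` (by `−p₃ = p₆`; "`g₁` induces the
translation by the 3-torsion point `p₃`" — the sign depends on letting matrices act on points or
on coordinates). [cite: ArtebaniDolgachev2009, §4] -/
theorem affine_σ₁ : ∀ i : Fin 9, 𝛂 (σ₁ i) = 𝛂 i + (0, 2) := by decide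

/-- `g₂` acts on `𝔽₃²` as the translation `v ↦ v + (1, 0)`, "by the point `p₁`".
[cite: ArtebaniDolgachev2009, §4] -/
theorem affine_σ₂ : ∀ i : Fin 9, 𝛂 (σ₂ i) = 𝛂 i + (1, 0) := by decide

/-- `g₃` acts on `𝔽₃²` linearly: `(a, b) ↦ (b, 2a)` (matrix `[[0, 1], [2, 0]]`, determinant `1`,
square `−1 = σ₀`: cf. `g₃² = 3g₀`). [cite: ArtebaniDolgachev2009, §4 ("transformations with
linear part of determinant 1")] -/
theorem affine_σ₃ : ∀ i : Fin 9, 𝛂 (σ₃ i) = ((𝛂 i).2, 2 * (𝛂 i).1) := by decide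

/-- `g₄` acts on `𝔽₃²` linearly: `(a, b) ↦ (a + 2b, b)` (matrix `[[1, 2], [0, 1]]`, determinant
`1`). [cite: ArtebaniDolgachev2009, §4] -/
theorem affine_σ₄ : ∀ i : Fin 9, 𝛂 (σ₄ i) = ((𝛂 i).1 + 2 * (𝛂 i).2, (𝛂 i).2) := by decide

/-- The linear parts of `σ₃`, `σ₄` have determinant `1` in `𝔽₃` (and those of the translations
`σ₁, σ₂` and of `σ₀ = −1` trivially): **"the Hessian group is the subgroup … of transformations
with linear part of determinant 1"**, on generators. [cite: ArtebaniDolgachev2009, §4] -/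
theorem det_linearPart_σ₃_σ₄ :
    (!![(0 : ZMod 3), 1; 2, 0]).det = 1 ∧ (!![(1 : ZMod 3), 2; 0, 1]).det = 1 ∧
      (!![(-1 : ZMod 3), 0; 0, -1]).det = 1 := by
  simp only [Matrix.det_fin_two_of]
  decide

/-! ## §4 A–D's generators `T`, `U` of the permutation representation -/

/-- `𝐓⁻¹` is the inverse of `T = (031)(475)(682)`. [cite: ArtebaniDolgachev2009, §4] -/
theorem T_inv_comp : (∀ i : Fin 9, 𝐓⁻¹ (𝐓 i) = i) ∧ ∀ i : Fin 9, 𝐓 (𝐓⁻¹ i) = i := by decide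

/-- **"`TUT⁻¹ = (354)(678)`"** for `T = (031)(475)(682)`, `U = (147)(285)` (permutations composed
left to right, [Coxeter] 7.7: `i ↦ T⁻¹(U(T(i)))`), and this is the permutation `σ₄` induced by
`g₄`. [cite: ArtebaniDolgachev2009, §4] -/
theorem T_U_T_inv : ∀ i : Fin 9, 𝐓⁻¹ (𝐔 (𝐓 i)) = σ₄ i := by decide

/-- `σ₄ = (354)(678)`: it fixes `0, 1, 2` and cycles `3 ↦ 5 ↦ 4 ↦ 3`, `6 ↦ 7 ↦ 8 ↦ 6`.
[cite: ArtebaniDolgachev2009, §4] -/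
theorem σ₄_cycles :
    σ₄ 0 = 0 ∧ σ₄ 1 = 1 ∧ σ₄ 2 = 2 ∧ σ₄ 3 = 5 ∧ σ₄ 5 = 4 ∧ σ₄ 4 = 3 ∧
      σ₄ 6 = 7 ∧ σ₄ 7 = 8 ∧ σ₄ 8 = 6 := by decide

/-- `U = (147)(285)` acts on `𝔽₃²` as the transvection `(a, b) ↦ (a, a + b)` and fixes `p₀`; with
`σ₃`, `σ₄` it lies in the stabilizer of `p₀` ("The stabilizer subgroup of the point `p₀` is
generated by `U` and `TUT⁻¹`"). [cite: ArtebaniDolgachev2009, §4] -/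
theorem affine_U : (∀ i : Fin 9, 𝛂 (𝐔 i) = ((𝛂 i).1, (𝛂 i).1 + (𝛂 i).2)) ∧ 𝐔 0 = 0 ∧
    σ₃ 0 = 0 ∧ σ₄ 0 = 0 := by decide

/-- `T = (031)(475)(682)` acts on `𝔽₃²` as the affine map `(a, b) ↦ (b, 2a + 2b + 1)` (linear
part `[[0, 1], [2, 2]]` of determinant `1`, translation part `(0, 1) = 𝛂(p₃)`), and `U` as the
transvection of `affine_U`: both lie in the index-2 subgroup of `Aff₂(3)` "of transformations
with linear part of determinant 1". [cite: ArtebaniDolgachev2009, §4] -/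
theorem affine_T : (∀ i : Fin 9, 𝛂 (𝐓 i) = ((𝛂 i).2, 2 * (𝛂 i).1 + 2 * (𝛂 i).2 + 1)) ∧
    (!![(0 : ZMod 3), 1; 2, 2]).det = 1 ∧ (!![(1 : ZMod 3), 0; 1, 1]).det = 1 := by
  refine ⟨by decide, ?_, ?_⟩ <;> simp only [Matrix.det_fin_two_of] <;> decide

end Literature.AlgebraicGeometry.PlaneCurves
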